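import Summits.NavierStokesRegularity.TurbBounds.Certs.P2R0.Evaluator
import Summits.NavierStokesRegularity.TurbBounds.LadderTail
import HarnessLib

/-!
# Row P2-R0 tail lemma, part 2 — the literal element rule `MelR` IS the tracked finite part (quadratic-form identity)
(cell `pub-turb` / `turb-bounds`; v2 staging of R-T. This discharges, for row P2-R0, LEAN-MAP's data item (a): 'the eight piece
matrices are the Legendre–Galerkin objects of rbsdp SPEC 3.3–3.6' — here as the statement that the quadratic form of
`Certs.P2R0.Evaluator.MelR ε u v` at a coefficient vector `x = (c_0..c_6; d_0..d_5)` is EXACTLY the tracked finite part of the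
Parseval form of the layer functional with the Young/tail corrections of SPEC 3.6, written with the explicit integration-ladder
linear forms `aL` (coefficients `a_0..a_5` of `V'`), `bL` (`b_0..b_4` of `V`), `eL` (`e_0..e_4` of `Θ`).)

HONEST FRAMING: rigorous bounds for the stated PDE and boundary conditions; no claim about physical turbulence beyond the bound.
Everything is kernel arithmetic on the literal rational matrices of `Certs/P2R0/EvalData.lean` (`simp` expansion + `ring`).
-/

set_option linter.style.longLine false
set_option linter.style.setOption false

namespace Summit.NavierStokesRegularity.TurbBounds.TailP2R0

open Finset Matrix Literature.Computation.Certificates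
open Summit.NavierStokesRegularity.TurbBounds.LadderTail (w phi lam)
open Summit.NavierStokesRegularity.TurbBounds.Certs.P2R0.Evaluator

/-- the `c`-block of a stacked coefficient vector `x = (c_0..c_6; d_0..d_5)` as a sequence -/
def xc (x : Fin 13 → ℝ) : ℕ → ℝ
  | 0 => x 0 | 1 => x 1 | 2 => x 2 | 3 => x 3 | 4 => x 4 | 5 => x 5 | 6 => x 6 | _ => 0

/-- the `d`-block of a stacked coefficient vector as a sequence -/
def xd (x : Fin 13 → ℝ) : ℕ → ℝ
  | 0 => x 7 | 1 => x 8 | 2 => x 9 | 3 => x 10 | 4 => x 11 | 5 => x 12 | _ => 0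

/-- the integration-ladder forms `a_n = c_{n-1}/(2n-1) - c_{n+1}/(2n+3)` (`a_0 = c_0 - c_1/3`), `n ≤ 5` (coefficients of `V'`;
rbsdp SPEC 3.3 `D1`) -/
noncomputable def aL (x : Fin 13 → ℝ) : ℕ → ℝ
  | 0 => x 0 - x 1 / 3
  | 1 => x 0 - x 2 / 5
  | 2 => x 1 / 3 - x 3 / 7
  | 3 => x 2 / 5 - x 4 / 9
  | 4 => x 3 / 7 - x 5 / 11
  | 5 => x 4 / 9 - x 6 / 13
  | _ => 0

/-- the twice-laddered forms `b_n`, `n ≤ 4` (coefficients of `V`; rbsdp SPEC 3.3 `D0`) -/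
noncomputable def bL (x : Fin 13 → ℝ) : ℕ → ℝ
  | 0 => aL x 0 - aL x 1 / 3
  | 1 => aL x 0 - aL x 2 / 5
  | 2 => aL x 1 / 3 - aL x 3 / 7
  | 3 => aL x 2 / 5 - aL x 4 / 9
  | 4 => aL x 3 / 7 - aL x 5 / 11
  | _ => 0

/-- the laddered forms `e_n`, `n ≤ 4`, on the `d`-block (coefficients of `Θ`; rbsdp SPEC 3.3 `DT`) -/
noncomputable def eL (x : Fin 13 → ℝ) : ℕ → ℝ
  | 0 => x 7 - x 8 / 3
  | 1 => x 7 - x 9 / 5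
  | 2 => x 8 / 3 - x 10 / 7
  | 3 => x 9 / 5 - x 11 / 9
  | 4 => x 10 / 7 - x 12 / 11
  | _ => 0

/-- The tracked finite part of the Parseval form with the SPEC 3.6 corrections, as an explicit function of the stacked vector. -/
noncomputable def finitePart (ε : ℚ) (u v : ℝ) (x : Fin 13 → ℝ) : ℝ :=
  ((s : ℚ) - 1 : ℝ) * (16 * u * ∑ n ∈ range 7, w n * xc x n ^ 2 + 8 * ∑ n ∈ range 6, w n * aL x n ^ 2
      + v * ∑ n ∈ range 5, w n * bL x n ^ 2)
    + ((s : ℚ) : ℝ) * (4 * ∑ n ∈ range 6, w n * xd x n ^ 2 + v * ∑ n ∈ range 5, w n * eL x n ^ 2)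
    + 2 * ((ghat0 : ℚ) : ℝ) * ∑ n ∈ range 5, w n * bL x n * eL x n
    - ((T : ℚ) : ℝ) * (ε : ℝ) * (phi 4 * aL x 4 ^ 2 + phi 5 * aL x 5 ^ 2 + lam 4 * (phi 5 * xc x 5 ^ 2 + phi 6 * xc x 6 ^ 2))
    - ((T : ℚ) : ℝ) / (ε : ℝ) * (phi 4 * xd x 4 ^ 2 + phi 5 * xd x 5 ^ 2)

set_option maxHeartbeats 1000000 in
/-- `xᵀ·Acoef·x = (s-1)·16·Σ_{n<7} w_n c_n²` (`Acoef = (s-1)·PWu`, `PWu = 16·diag(2/(2n+1)) ⊕ 0`). -/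
theorem quadForm_Acoef (x : Fin 13 → ℝ) :
    x ⬝ᵥ (Acoef.map (Rat.cast : ℚ → ℝ) *ᵥ x) = ((s : ℚ) - 1 : ℝ) * (16 * ∑ n ∈ range 7, w n * xc x n ^ 2) := by
  simp [dotProduct, mulVec, Fin.sum_univ_succ, Acoef, PWu, PWu_rows, List.getD, sum_range_succ, xc, w, s]
  ring

set_option maxHeartbeats 1000000 in
/-- `xᵀ·Bcoef·x = (s-1)·Σ_{n<5} w_n b_n² + s·Σ_{n<5} w_n e_n²` (`Bcoef = (s-1)·D0ᵀWD0 ⊕ s·DTᵀWDT`). -/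
theorem quadForm_Bcoef (x : Fin 13 → ℝ) :
    x ⬝ᵥ (Bcoef.map (Rat.cast : ℚ → ℝ) *ᵥ x)
      = ((s : ℚ) - 1 : ℝ) * ∑ n ∈ range 5, w n * bL x n ^ 2 + ((s : ℚ) : ℝ) * ∑ n ∈ range 5, w n * eL x n ^ 2 := by
  simp [dotProduct, mulVec, Fin.sum_univ_succ, Bcoef, PWv, PWv_rows, PTv, PTv_rows, List.getD, sum_range_succ, bL, aL, eL, w, s]
  ring

set_option maxHeartbeats 1000000 in
/-- `xᵀ·M0(ε)·x` = the data-free part: `(s-1)·8Σ w a² + s·4Σ w d² + 2ĝ₀ Σ_{n≤4} w b e - Tε·(W-tail Gram) - (T/ε)·(Θ-tail Gram)`. -/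
theorem quadForm_M0 (ε : ℚ) (x : Fin 13 → ℝ) :
    x ⬝ᵥ ((M0 ε).map (Rat.cast : ℚ → ℝ) *ᵥ x)
      = ((s : ℚ) - 1 : ℝ) * (8 * ∑ n ∈ range 6, w n * aL x n ^ 2)
        + ((s : ℚ) : ℝ) * (4 * ∑ n ∈ range 6, w n * xd x n ^ 2)
        + 2 * ((ghat0 : ℚ) : ℝ) * ∑ n ∈ range 5, w n * bL x n * eL x n
        - ((T : ℚ) : ℝ) * (ε : ℝ) * (phi 4 * aL x 4 ^ 2 + phi 5 * aL x 5 ^ 2 + lam 4 * (phi 5 * xc x 5 ^ 2 + phi 6 * xc x 6 ^ 2))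
        - ((T : ℚ) : ℝ) / (ε : ℝ) * (phi 4 * xd x 4 ^ 2 + phi 5 * xd x 5 ^ 2) := by
  simp [dotProduct, mulVec, Fin.sum_univ_succ, M0, PW0, PW0_rows, PT0, PT0_rows, CE0, CE0_rows, TW, TW_rows, TT, TT_rows,
    List.getD, sum_range_succ, bL, aL, eL, xc, xd, w, phi, lam, s, ghat0, T]
  ring

/-- **The quadratic form of the literal rule is the tracked finite part**: `xᵀ·MelR(ε; u, v)·x = finitePart ε u v x`. -/
theorem quadForm_MelR (ε : ℚ) (u v : ℝ) (x : Fin 13 → ℝ) :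
    x ⬝ᵥ (MelR ε u v *ᵥ x) = finitePart ε u v x := by
  unfold MelR finitePart
  rw [add_mulVec, add_mulVec, dotProduct_add, dotProduct_add, smul_mulVec, smul_mulVec, dotProduct_smul,
    dotProduct_smul, quadForm_M0, quadForm_Acoef, quadForm_Bcoef, smul_eq_mul, smul_eq_mul]
  ring

/-- Consequence: if `MelR ε u v ⪰ 0` then the tracked finite part is `≥ 0` at every stacked vector. -/
theorem finitePart_nonneg {ε : ℚ} {u v : ℝ} (h : (MelR ε u v).PosSemidef) (x : Fin 13 → ℝ) : 0 ≤ finitePart ε u v x := by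
  have h2 := h.dotProduct_mulVec_nonneg x
  rwa [star_trivial, quadForm_MelR] at h2

end Summit.NavierStokesRegularity.TurbBounds.TailP2R0
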